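import Literature.AnabelianGeometry.SemiGraphs.CoveringGraphStrictlyCoherent
import HarnessLib

/-!
# The structure morphism `G_S → G` of a covering semi-graph of anabelioids is locally open

Mochizuki, *Semi-graphs of anabelioids*, Publ. RIMS **42** (2006), §3 Def. 3.5 (i) p. 37 (coverings
`G' → G` attached to objects of `B^cov(G)`), Def. 2.2 (ii) p. 24 (locally open / locally trivial
morphisms), Remark 3.5.2 p. 37 [cite: MochizukiSemiAnbd2006, Def 3.5(i) p.37].  In the local
presentation (`CovObj.coveringGraph`, `CovObj.coveringHom` of `TemperedReconstruction`) the constituent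
homomorphisms of the structure morphism `G_S → G` ARE the inclusions of the open stabilisers
`Stab_{Π_v}(s_ω) ↪ Π_v`, `Stab_{Π_e}(s_ω) ↪ Π_e`.  Recorded here for consumers (Prop. 3.6 (iv)/(v), the
§4 "tempered ⇒ locally finite étale" law, route T):

* `coveringHom_base_vertexMap` / `_edgeMap` / `_branchMap` (the projections), `coveringHom_hV_apply` /
  `_hE_apply`;
* `coveringHom_hV_injective` / `_hE_injective`, `range_coveringHom_hV` / `_hE` (`= Stab`),
  `isOpen_range_coveringHom_hV` / `_hE`, `isOpenEmbedding_coveringHom_hV` / `_hE`;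
* `coveringHom_isLocallyOpen : S.coveringHom.IsLocallyOpen` (Def. 2.2 (ii));
* `index_range_coveringHom_hV_ne_zero` / `_hE_…` (open subgroups of compact groups have finite index)
  and, for `S` tempered and connected over a connected `G`, ONE bound for all these indices
  (`exists_index_range_coveringHom_le`, from `exists_index_stab_le`).

Proof-only (abc-iut cell, L3 route T support; seat abc-iut-L3-d6); no definition; nothing here bears
on [IUTchIII] Cor. 3.12.
-/

open CategoryTheory Topology

namespace Literature.AnabelianGeometry.SemiGraphs

namespace ProfiniteSemiGraph

namespace CovObj

open Literature.AlgebraicGeometry.Frobenioids (IsConnectedObj)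

universe u

variable {𝒢 : ProfiniteSemiGraph.{u}} (S : CovObj 𝒢)

/-! ### The underlying morphism of semi-graphs: the projections -/

/-- `G_S → G` on vertices is `(v, ω) ↦ v`. [cite: MochizukiSemiAnbd2006, Def 3.5(i) p.37] -/
@[simp] theorem coveringHom_base_vertexMap (v' : S.coveringGraph.graph.Vertex) :
    S.coveringHom.base.vertexMap v' = v'.1 := rfl

/-- `G_S → G` on edges is `(e, ω) ↦ e`. [cite: MochizukiSemiAnbd2006, Def 3.5(i) p.37] -/
@[simp] theorem coveringHom_base_edgeMap (e' : S.coveringGraph.graph.Edge) :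
    S.coveringHom.base.edgeMap e' = e'.1 := rfl

/-- `G_S → G` on branches is `(b, ω) ↦ b`. [cite: MochizukiSemiAnbd2006, Def 3.5(i) p.37] -/
@[simp] theorem coveringHom_base_branchMap (b' : S.coveringGraph.graph.Branch) :
    S.coveringHom.base.branchMap b' = b'.1 := rfl

/-! ### The constituent homomorphisms: inclusions of open stabilisers -/

/-- The vertex homomorphism of `G_S → G` at `(v, ω)` is the inclusion `Stab_{Π_v}(s_ω) ↪ Π_v`.
[cite: MochizukiSemiAnbd2006, Def 3.5(i) p.37] -/
@[simp] theorem coveringHom_hV_apply (v' : S.coveringGraph.graph.Vertex) (k : S.coveringGraph.Gv v') :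
    S.coveringHom.hV v' k = (k : 𝒢.Gv v'.1) := rfl

/-- The edge homomorphism of `G_S → G` at `(e, ω)` is the inclusion `Stab_{Π_e}(s_ω) ↪ Π_e`.
[cite: MochizukiSemiAnbd2006, Def 3.5(i) p.37] -/
@[simp] theorem coveringHom_hE_apply (e' : S.coveringGraph.graph.Edge) (k : S.coveringGraph.Ge e') :
    S.coveringHom.hE e' k = (k : 𝒢.Ge e'.1) := rfl

/-- The vertex homomorphisms of `G_S → G` are injective. [cite: MochizukiSemiAnbd2006, Rmk 3.5.2 p.37] -/
theorem coveringHom_hV_injective (v' : S.coveringGraph.graph.Vertex) :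
    Function.Injective (S.coveringHom.hV v') := fun _ _ h => Subtype.ext h

/-- The edge homomorphisms of `G_S → G` are injective. [cite: MochizukiSemiAnbd2006, Rmk 3.5.2 p.37] -/
theorem coveringHom_hE_injective (e' : S.coveringGraph.graph.Edge) :
    Function.Injective (S.coveringHom.hE e') := fun _ _ h => Subtype.ext h

/-- The image of `Π_{(v,ω)} → Π_v` is the stabiliser `Stab_{Π_v}(s_ω)`. [cite: MochizukiSemiAnbd2006, Def 3.5(i) p.37] -/
theorem range_coveringHom_hV (v' : S.coveringGraph.graph.Vertex) :
    (S.coveringHom.hV v').toMonoidHom.range = BTemp.stab (S.SV v'.1) (Quot.out v'.2) :=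
  Subgroup.range_subtype _

/-- The image of `Π_{(e,ω)} → Π_e` is the stabiliser `Stab_{Π_e}(s_ω)`. [cite: MochizukiSemiAnbd2006, Def 3.5(i) p.37] -/
theorem range_coveringHom_hE (e' : S.coveringGraph.graph.Edge) :
    (S.coveringHom.hE e').toMonoidHom.range = BTemp.stab (S.SE e'.1) (Quot.out e'.2) :=
  Subgroup.range_subtype _

/-- The image of `Π_{(v,ω)} → Π_v` is open (stabilisers of points of objects of `B^temp(Π_v)` are open).
[cite: MochizukiSemiAnbd2006, Def 2.2(ii) p.24] -/
theorem isOpen_range_coveringHom_hV (v' : S.coveringGraph.graph.Vertex) :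
    IsOpen ((S.coveringHom.hV v').toMonoidHom.range : Set (𝒢.Gv (S.coveringHom.base.vertexMap v'))) := by
  rw [range_coveringHom_hV]
  exact (S.SV v'.1).property.2 _

/-- The image of `Π_{(e,ω)} → Π_e` is open. [cite: MochizukiSemiAnbd2006, Def 2.2(ii) p.24] -/
theorem isOpen_range_coveringHom_hE (e' : S.coveringGraph.graph.Edge) :
    IsOpen ((S.coveringHom.hE e').toMonoidHom.range : Set (𝒢.Ge (S.coveringHom.base.edgeMap e'))) := by
  rw [range_coveringHom_hE]
  exact (S.SE e'.1).property.2 _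

/-- `Π_{(v,ω)} → Π_v` is an open embedding of topological groups. [cite: MochizukiSemiAnbd2006, Def 2.2(ii) p.24] -/
theorem isOpenEmbedding_coveringHom_hV (v' : S.coveringGraph.graph.Vertex) :
    IsOpenEmbedding (S.coveringHom.hV v') :=
  ((S.SV v'.1).property.2 (Quot.out v'.2)).isOpenEmbedding_subtypeVal

/-- `Π_{(e,ω)} → Π_e` is an open embedding of topological groups. [cite: MochizukiSemiAnbd2006, Def 2.2(ii) p.24] -/
theorem isOpenEmbedding_coveringHom_hE (e' : S.coveringGraph.graph.Edge) :
    IsOpenEmbedding (S.coveringHom.hE e') :=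
  ((S.SE e'.1).property.2 (Quot.out e'.2)).isOpenEmbedding_subtypeVal

/-- **The structure morphism `G_S → G` is locally open** (Def. 2.2 (ii): every constituent
homomorphism has open image) — so Prop. 3.6 (iv) makes `B^temp(G_S) → B^temp(G)` relatively temp-slim,
and the constituents of `G_S → G` are "finite étale" in the sense of Rmk. 3.5.2.
[cite: MochizukiSemiAnbd2006, Def 2.2(ii) p.24] -/
theorem coveringHom_isLocallyOpen : S.coveringHom.IsLocallyOpen :=
  ⟨S.isOpen_range_coveringHom_hV, S.isOpen_range_coveringHom_hE⟩

/-! ### Finite index -/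

/-- An open subgroup of a compact topological group has finite (nonzero) index. [folklore] -/
private theorem index_ne_zero_of_isOpen {G : Type*} [Group G] [TopologicalSpace G] [IsTopologicalGroup G]
    [CompactSpace G] (U : Subgroup G) (hU : IsOpen (U : Set G)) : U.index ≠ 0 := by
  haveI : Finite (G ⧸ U) := Subgroup.quotient_finite_of_isOpen U hU
  exact (Subgroup.finiteIndex_of_finite_quotient (H := U)).index_ne_zero

/-- The image of `Π_{(v,ω)} → Π_v` has finite index ("finite étale" constituents, Rmk. 3.5.2).
[cite: MochizukiSemiAnbd2006, Rmk 3.5.2 p.37] -/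
theorem index_range_coveringHom_hV_ne_zero (v' : S.coveringGraph.graph.Vertex) :
    (S.coveringHom.hV v').toMonoidHom.range.index ≠ 0 :=
  index_ne_zero_of_isOpen _ (S.isOpen_range_coveringHom_hV v')

/-- The image of `Π_{(e,ω)} → Π_e` has finite index. [cite: MochizukiSemiAnbd2006, Rmk 3.5.2 p.37] -/
theorem index_range_coveringHom_hE_ne_zero (e' : S.coveringGraph.graph.Edge) :
    (S.coveringHom.hE e').toMonoidHom.range.index ≠ 0 :=
  index_ne_zero_of_isOpen _ (S.isOpen_range_coveringHom_hE e')

/-- For `S` tempered and connected over a connected `G`, the indices of all the constituent images of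
`G_S → G` are bounded by ONE integer (the degree of a finite étale covering splitting `S`).
[cite: MochizukiSemiAnbd2006, Def 3.5(ii) p.37] -/
theorem exists_index_range_coveringHom_le (hconn : 𝒢.IsConnected) (hS : S.IsTempered)
    (hSc : IsConnectedObj (⟨S, hS⟩ : BTempCat 𝒢)) :
    ∃ D : ℕ, (∀ v' : S.coveringGraph.graph.Vertex, (S.coveringHom.hV v').toMonoidHom.range.index ≤ D) ∧
      ∀ e' : S.coveringGraph.graph.Edge, (S.coveringHom.hE e').toMonoidHom.range.index ≤ D := by
  obtain ⟨D, hDV, hDE⟩ := S.exists_index_stab_le hconn hS hSc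
  refine ⟨D, fun v' => ?_, fun e' => ?_⟩
  · rw [range_coveringHom_hV]
    exact (hDV v'.1 _).2
  · rw [range_coveringHom_hE]
    exact (hDE e'.1 _).2

end CovObj

end ProfiniteSemiGraph

end Literature.AnabelianGeometry.SemiGraphs
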